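import Summits.QuantumFields.BalabanUV.T4Continuum.Spine.NE2.ComposedAveragingRate
import Summits.QuantumFields.BalabanUV.T4Continuum.Spine.NE2BalabanFlatWitness

/-!
# T⁴ programme, spine node NE2 (U1a) — R14 W2: NON-VACUITY of the composed-averaging END at the FLAT data tower
# (cell `pub-balaban-gaps`, seat ne2 gen 4; census `run/shared/lean/pub/pub-balaban-gaps/ne/NE2.md` §12)

`ComposedAveragingRate.composed_averaging_rate` displays: row B5's class `hreg`, node NE3's `LocalRate` `hNE3`, three data letters on the tower of averaged fields `W`, a fourth-slot law
`hP₄`, and the threshold `κ_B < 1`.  THIS FILE discharges ALL of them at the flat point — `R :=` the flat transporters (`NE2BalabanFlatWitness.regularTransporters_flat`,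
`localRate_flat`, `α = β = C = 0`), `W ≡ 1` (`α = σ = θ_c = 0`), `P₄ := 0` (`PerturbationAlgebra.perturbationLaws_zero`), threshold `κ_B = 0 < 1` — so the binder set is JOINTLY
SATISFIABLE (**`composed_averaging_rate_flat`**, every rate `3/(2L) ≤ ρ < 1`); and records that at the flat tower the composed table term VANISHES (`avgPertT_TBal_one`:
`TBal 1 ≡ 1`, `Q_k(1) = Q_k ⊗ 1`), so the instance is the free tower's rate (`free_rate_of_composed_flat`) — a consistency check, nothing about non-trivial data.
HONEST FRAMING (T4-DAG p. 1).  Non-vacuity bookkeeping; NOT NE2; NE2 (U1a) NOT PROVED; spine PROVED 0/9 unchanged; NOT continuum YM / infinite volume / mass gap / Clay.  HONEST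
DEPENDENCY: continuum YM on T⁴ ⇐ BetaPertH ∧ nine spine estimates (0/9 proved); BetaPertH ⇐ (D1) ∧ (D4) ∧ CAP+tail; G-an2-4 gates asym, D1 and NE2/3/4.  No `sorry`, no `def`.
-/

noncomputable section

open scoped BigOperators ComplexConjugate Matrix Matrix.Norms.L2Operator Kronecker

namespace Summit.QuantumFields.BalabanUV.T4Continuum.NE2.ComposedAveragingFlatWitness

open Literature.MathematicalPhysics.QuantumFieldTheory.Balaban1983to89.B5Prop11Plancherel (Tor fine Cst)
open Literature.MathematicalPhysics.QuantumFieldTheory.Balaban1983to89.B5Block118 (QvOp)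
open Literature.MathematicalPhysics.QuantumFieldTheory.Balaban1983to89.B5G183RateUnitTower (lev)
open Summit.QuantumFields.BalabanUV.T4Continuum
open Summit.QuantumFields.BalabanUV.T4Continuum.BalabanAveragedTowerUnit (idx Qlev)
open Summit.QuantumFields.BalabanUV.T4Continuum.KingPairingPlantedLaw (JpcT calDalev CJ)
open Summit.QuantumFields.BalabanUV.T4Continuum.GramPerturbationLaw (C2gram)
open Summit.QuantumFields.BalabanUV.T4Continuum.CovariantAveragingTower (TowerLimitRate)
open Summit.QuantumFields.BalabanUV.T4Continuum.BackgroundResolventTower (PerturbationLaws Cpert)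
open Summit.QuantumFields.BalabanUV.T4Continuum.PerturbationAlgebra (perturbationLaws_zero perturbationLaws_mono)
open Summit.QuantumFields.BalabanUV.T4Continuum.RegularBackgroundTower (betaNE3)
open Summit.QuantumFields.BalabanUV.T4Continuum.ColourCovariantLaplacian (kappaCol)
open Summit.QuantumFields.BalabanUV.T4Continuum.CovariantAveragingSummand (kappaQ)
open Summit.QuantumFields.BalabanUV.T4Continuum.NE2BalabanLayer (tierBPert kappaB C2B)
open Summit.QuantumFields.BalabanUV.T4Continuum.NE2BalabanGauge (liftR)
open Summit.QuantumFields.BalabanUV.T4Continuum.GaugeTermPerturbationLaw (oneR)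
open Summit.QuantumFields.BalabanUV.T4Continuum.NE2BalabanFlatWitness (regularTransporters_flat localRate_flat covPertC_flat)
open Summit.QuantumFields.BalabanUV.T4Continuum.KroneckerLift (kron_mul kron_conjTranspose)
open Summit.QuantumFields.BalabanUV.T4Continuum.NE2.CovariantTableAveraging (QcovT_const_one)
open Summit.QuantumFields.BalabanUV.T4Continuum.NE2.CovariantTableTower (QcovLevT avgPertT)
open Summit.QuantumFields.BalabanUV.T4Continuum.NE2.CovariantTableBalaban (TBal TBal_one)
open Summit.QuantumFields.BalabanUV.T4Continuum.NE2.ComposedAveragingMean (thetaZero)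
open Summit.QuantumFields.BalabanUV.T4Continuum.NE2.ComposedAveragingRate (composed_averaging_rate)

variable {d : ℕ} (L : ℕ) [NeZero L] (M : Fin d → ℕ) [hM : ∀ μ, NeZero (M μ)] {o : Type*} [Fintype o] [DecidableEq o] [Nonempty o] (a : ℝ) (ha : 0 < a)

omit [Nonempty o] in
/-- **AT THE FLAT DATA TOWER THE COMPOSED TABLE TERM VANISHES**: `TBal 1 ≡ 1`, so `Q_k(T_Bal) = Q_k ⊗ 1` and `a·(n^dQ_k(T)ᴴQ_k(T) − QᴴQ⊗1) = 0`. [folklore] -/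
theorem avgPertT_TBal_one (k : ℕ) : avgPertT L M a (fun k => TBal L M (fun _ _ _ => (1 : Matrix o o ℂ)) k) k = 0 := by
  rw [avgPertT, QcovLevT, TBal_one, QcovT_const_one, kron_conjTranspose, ← kron_mul, sub_self, smul_zero, smul_zero]

include ha in
/-- **NON-VACUITY OF THE COMPOSED-AVERAGING END** (`L ≥ 2`, `d ≥ 1`, `3/(2L) ≤ ρ < 1`): at the flat point — `R :=` the flat transporters (`α = β = C = 0`), `W ≡ 1` (`α = σ = θ_c = 0`),
`P₄ := 0` — EVERY displayed binder of `ComposedAveragingRate.composed_averaging_rate` is discharged and the threshold is `κ_B = 0 < 1`: the binder set is jointly satisfiable.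
NOT a statement about non-trivial data; NE2 NOT proved. [folklore] -/
theorem composed_averaging_rate_flat (hL : 2 ≤ L) (hd : 1 ≤ d) {ρ : ℝ} (hρ : 3 / (2 * (L : ℝ)) ≤ ρ) (hρ1 : ρ < 1) :
    TowerLimitRate (fun k => Qlev L M k ⊗ₖ (1 : Matrix o o ℂ)) ((L : ℝ) ^ d)
      (fun k => (calDalev L M a ha k ⊗ₖ (1 : Matrix o o ℂ)
        + tierBPert L M (liftR L M (oneR L M (o := o))) (avgPertT L M a fun k => TBal L M (fun _ _ _ => (1 : Matrix o o ℂ)) k)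
            (fun _ => 0) k)⁻¹)
      (Cpert (kappaB o d a 0 0 0 (kappaQ d a (a : ℂ) (Fintype.card o * (Real.exp ((((d + 1) * L : ℕ) : ℝ) * 0) - 1))) 0) (2 * d * Cst d a) (CJ d a)
        (C2B o d L a 0 0 0
          (a * C2gram (Cst d a) 1 (Fintype.card o * (Real.exp ((((d + 1) * L : ℕ) : ℝ) * 0) - 1)) (2 * d * Cst d a) (CJ d a) (Cst d a)
            (Cst d a * Fintype.card o * (thetaZero d L 0 0 + (Real.exp ((((d + 1) * L : ℕ) : ℝ) * 0) - 1)))) 0) 0 1) ρ := by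
  have hL1 : (1 : ℝ) ≤ L := by exact_mod_cast (by omega : 1 ≤ L)
  have hρ0 : 0 ≤ ρ := le_trans (by positivity) hρ
  have hP₄ : PerturbationLaws (fun k => calDalev L M a ha k ⊗ₖ (1 : Matrix o o ℂ)) (fun k => (0 : Matrix (idx L M k × o) (idx L M k × o) ℂ))
      (fun k => JpcT L M k ⊗ₖ (1 : Matrix o o ℂ)) 0 (fun k => (0 : ℝ) * ρ ^ k) :=
    perturbationLaws_mono perturbationLaws_zero le_rfl fun k => le_of_eq (by ring)
  have hsmall : kappaB o d a 0 0 0 (kappaQ d a (a : ℂ) (Fintype.card o * (Real.exp ((((d + 1) * L : ℕ) : ℝ) * 0) - 1))) 0 < 1 := by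
    simp [kappaB, kappaCol, kappaQ, betaNE3]
  exact composed_averaging_rate L M a ha hL hd (regularTransporters_flat L M) le_rfl (localRate_flat L M le_rfl (inv_nonneg.mpr (Nat.cast_nonneg L)))
    (W := fun (_ : ℕ) (i : ℕ) (_ : Fin d) (_ : idx L M i) => (1 : Matrix o o ℂ)) (α := 0) (σ := 0) (θc := 0)
    le_rfl le_rfl le_rfl zero_le_one hρ0 hρ hρ1
    (fun _ _ _ _ => norm_one.le) (fun _ _ _ _ => by rw [sub_self, norm_zero]; positivity) (fun _ _ _ _ _ => by rw [sub_self, norm_zero]; positivity)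
    hP₄ hsmall

include ha in
/-- **THE FLAT INSTANCE IS THE FREE TOWER's RATE** (consistency check): at the flat point the whole tier-B perturbation with the composed averaging term vanishes
(`covPertC_flat`, `avgPertT_TBal_one`), so the END reads — the King-averaged covariances of the FREE operators converge at rate `ρ`. [folklore] -/
theorem free_rate_of_composed_flat (hL : 2 ≤ L) (hd : 1 ≤ d) {ρ : ℝ} (hρ : 3 / (2 * (L : ℝ)) ≤ ρ) (hρ1 : ρ < 1) :
    TowerLimitRate (fun k => Qlev L M k ⊗ₖ (1 : Matrix o o ℂ)) ((L : ℝ) ^ d)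
      (fun k => (calDalev L M a ha k ⊗ₖ (1 : Matrix o o ℂ))⁻¹)
      (Cpert (kappaB o d a 0 0 0 (kappaQ d a (a : ℂ) (Fintype.card o * (Real.exp ((((d + 1) * L : ℕ) : ℝ) * 0) - 1))) 0) (2 * d * Cst d a) (CJ d a)
        (C2B o d L a 0 0 0
          (a * C2gram (Cst d a) 1 (Fintype.card o * (Real.exp ((((d + 1) * L : ℕ) : ℝ) * 0) - 1)) (2 * d * Cst d a) (CJ d a) (Cst d a)
            (Cst d a * Fintype.card o * (thetaZero d L 0 0 + (Real.exp ((((d + 1) * L : ℕ) : ℝ) * 0) - 1)))) 0) 0 1) ρ := by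
  have h := composed_averaging_rate_flat L M a ha (o := o) hL hd hρ hρ1
  have hz : ∀ k, tierBPert L M (liftR L M (oneR L M (o := o))) (avgPertT L M a fun k => TBal L M (fun _ _ _ => (1 : Matrix o o ℂ)) k)
      (fun _ => 0) k = 0 := by
    intro k
    rw [tierBPert, covPertC_flat, avgPertT_TBal_one, add_zero, add_zero]
  simpa only [hz, add_zero] using h

end Summit.QuantumFields.BalabanUV.T4Continuum.NE2.ComposedAveragingFlatWitness

end
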